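import Literature.Probability.Percolation.TriDiscreteDomain
import Literature.Probability.Percolation.SitePercolationMeasure
import HarnessLib

/-!
# Discrete domains of `𝕋`: measurability of the crossing and separating events, and (10)

Topic `Literature/Probability/Percolation`. First proofs about the objects of
`TriDiscreteDomain.lean` (Bollobás–Riordan, *Percolation* (2006), Ch. 7 §7.2.2–7.2.4): the
crossing events `openCrossing` and the separating events `sepEvent` of a marked discrete
domain are *measurable* (they are finite unions of cylinders `{ω | S ⊆ ω}`, `S` a set of sites of
the finite domain), and the elementary identity **(10)** p. 180,
`fⁱ(z) - fⁱ(w) = hⁱ(w, z) - hⁱ(z, w)` ("trivially").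

## References

* B. Bollobás, O. Riordan, *Percolation*, CUP (2006), Ch. 7, §7.2.2 (p. 169), §7.2.4 ((9), (10)
  p. 180).
-/

noncomputable section

open Set MeasureTheory

namespace Literature.Probability.Percolation

/-- Cylinder events `{ω | S ⊆ ω}` of finitely many sites are measurable. [folklore] -/
theorem measurableSet_superset (S : Finset (LatticeModels.Site 2)) :
    MeasurableSet {ω : SiteConfig (LatticeModels.Site 2) | (S : Set (LatticeModels.Site 2)) ⊆ ω} := by
  have h : {ω : SiteConfig (LatticeModels.Site 2) | (S : Set (LatticeModels.Site 2)) ⊆ ω} = ⋂ x ∈ S, {ω | x ∈ ω} := by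
    ext ω
    simp only [mem_setOf_eq, mem_iInter]
    rfl
  rw [h]
  exact Finset.measurableSet_biInter S fun x _ => measurableSet_mem x

namespace TriMarkedDomain

variable {k : ℕ}

/-- **Crossing events are measurable** (finite unions of cylinders). [folklore] -/
theorem measurableSet_openCrossing (D : TriMarkedDomain k) (i j : Fin k) :
    MeasurableSet (D.openCrossing i j) := by
  classical
  have h : D.openCrossing i j = ⋃ S ∈ D.verts.powerset.filter
      (fun S : Finset (LatticeModels.Site 2) => ∃ u ∈ D.arc i, ∃ v ∈ D.arc j, PathIn LatticeModels.triGraph (↑S) u v),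
        {ω : SiteConfig (LatticeModels.Site 2) | (↑S : Set (LatticeModels.Site 2)) ⊆ ω} := by
    ext ω
    simp only [openCrossing, IsOpenCrossing, mem_setOf_eq, mem_iUnion, Finset.mem_filter,
      Finset.mem_powerset, exists_prop]
    constructor
    · rintro ⟨u, hu, v, hv, hp⟩
      refine ⟨D.verts.filter (· ∈ ω), ⟨Finset.filter_subset _ _, u, hu, v, hv, ?_⟩, ?_⟩
      · refine hp.mono ?_
        intro x hx
        simpa using hx
      · intro x hx
        have := Finset.mem_filter.1 (Finset.mem_coe.1 hx)
        exact this.2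
    · rintro ⟨S, ⟨hS, u, hu, v, hv, hp⟩, hω⟩
      refine ⟨u, hu, v, hv, hp.mono fun x hx => ⟨Finset.mem_coe.2 (hS (Finset.mem_coe.1 hx)), hω hx⟩⟩
  rw [h]
  exact Finset.measurableSet_biUnion _ fun S _ => measurableSet_superset S

/-- **Separating events are measurable** (finite unions of cylinders: the conditions on the
path other than openness do not involve the configuration). [folklore] -/
theorem measurableSet_sepEvent (D : TriMarkedDomain 3) (i : Fin 3) (z : LatticeModels.HexVertex) :
    MeasurableSet (D.sepEvent i z) := by
  classical
  have h : D.sepEvent i z = ⋃ S ∈ D.verts.powerset.filter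
      (fun S : Finset (LatticeModels.Site 2) => ∃ (u v : LatticeModels.Site 2) (P : LatticeModels.triGraph.Walk u v), P.IsPath ∧
        u ∈ D.arc (i + 1) ∧ v ∈ D.arc (i + 2) ∧ (∀ x ∈ P.support, x ∈ S) ∧
          Separates D.verts {e | e ∈ P.edges} z (D.stretch i)),
        {ω : SiteConfig (LatticeModels.Site 2) | (↑S : Set (LatticeModels.Site 2)) ⊆ ω} := by
    ext ω
    simp only [sepEvent, mem_setOf_eq, mem_iUnion, Finset.mem_filter, Finset.mem_powerset,
      exists_prop]
    constructor
    · rintro ⟨u, v, P, hP, hu, hv, hsupp, hsep⟩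
      refine ⟨P.support.toFinset, ⟨fun x hx => (hsupp x (List.mem_toFinset.1 hx)).1, u, v, P, hP,
        hu, hv, fun x hx => List.mem_toFinset.2 hx, hsep⟩, ?_⟩
      intro x hx
      exact (hsupp x (List.mem_toFinset.1 (Finset.mem_coe.1 hx))).2
    · rintro ⟨S, ⟨hS, u, v, P, hP, hu, hv, hsupp, hsep⟩, hω⟩
      exact ⟨u, v, P, hP, hu, hv, fun x hx => ⟨hS (hsupp x hx), hω (Finset.mem_coe.2 (hsupp x hx))⟩,
        hsep⟩
  rw [h]
  exact Finset.measurableSet_biUnion _ fun S _ => measurableSet_superset S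

/-- **(10) of Bollobás–Riordan 2006, Ch. 7 (p. 180)**: `fⁱ(z) - fⁱ(w) = hⁱ(w, z) - hⁱ(z, w)`
("Note that, trivially, …"; both sides equal `P(Eⁱ(z)) - P(Eⁱ(w))` by additivity on the
measurable events). [cite: BollobasRiordan2006, Ch. 7 (10) p. 180] -/
theorem sepProb_sub_sepProb (D : TriMarkedDomain 3) (i : Fin 3) (w z : LatticeModels.HexVertex) :
    D.sepProb i z - D.sepProb i w = D.sepDiffProb i w z - D.sepDiffProb i z w := by
  unfold sepProb sepDiffProb
  set μ := LatticeModels.triSitePercolation half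
  set A := D.sepEvent i z
  set B := D.sepEvent i w
  have hA : MeasurableSet A := D.measurableSet_sepEvent i z
  have hB : MeasurableSet B := D.measurableSet_sepEvent i w
  have h1 : μ.real A = μ.real (A ∩ B) + μ.real (A \ B) :=
    (measureReal_inter_add_sdiff (μ := μ) (s := A) hB).symm
  have h2 : μ.real B = μ.real (B ∩ A) + μ.real (B \ A) :=
    (measureReal_inter_add_sdiff (μ := μ) (s := B) hA).symm
  rw [Set.inter_comm B A] at h2
  linarith

/-! ### The boundary cycle and the arcs -/

variable (D : TriMarkedDomain k)

/-- The boundary traversal is periodic with period the number of boundary darts. [folklore] -/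
theorem triBdryIter_add_bdryLen (n : ℕ) :
    triBdryIter D.verts D.base (n + D.bdryLen) = triBdryIter D.verts D.base n := by
  unfold triBdryIter
  rw [Function.iterate_add_apply]
  exact congrArg _ D.cycle_len

/-- The boundary traversal is periodic. [folklore] -/
theorem triBdryIter_add_mul_bdryLen (n q : ℕ) :
    triBdryIter D.verts D.base (n + q * D.bdryLen) = triBdryIter D.verts D.base n := by
  induction q with
  | zero => simp
  | succ q ih => rw [Nat.succ_mul, ← add_assoc, triBdryIter_add_bdryLen, ih]

/-- The stretches end within the cycle: `nextPos i ≤ #∂`. [folklore] -/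
theorem nextPos_le_bdryLen (i : Fin k) : D.nextPos i ≤ D.bdryLen := by
  unfold nextPos
  split_ifs with h
  · exact (D.pos_lt _).le
  · exact le_rfl

/-- Membership in an arc: the tails of the darts of the stretch. [folklore] -/
theorem mem_arc_iff {i : Fin k} {x : LatticeModels.Site 2} :
    x ∈ D.arc i ↔ ∃ n, D.pos i ≤ n ∧ n < D.nextPos i ∧ (triBdryIter D.verts D.base n).1 = x := by
  simp only [arc, stretch, Finset.mem_image, Finset.mem_Ico]
  constructor
  · rintro ⟨d, ⟨n, ⟨h1, h2⟩, rfl⟩, rfl⟩; exact ⟨n, h1, h2, rfl⟩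
  · rintro ⟨n, h1, h2, rfl⟩; exact ⟨_, ⟨n, ⟨h1, h2⟩, rfl⟩, rfl⟩

/-- Membership in an outer arc: the heads of the darts of the stretch. [folklore] -/
theorem mem_outerArc_iff {i : Fin k} {x : LatticeModels.Site 2} :
    x ∈ D.outerArc i ↔ ∃ n, D.pos i ≤ n ∧ n < D.nextPos i ∧ (triBdryIter D.verts D.base n).2 = x := by
  simp only [outerArc, stretch, Finset.mem_image, Finset.mem_Ico]
  constructor
  · rintro ⟨d, ⟨n, ⟨h1, h2⟩, rfl⟩, rfl⟩; exact ⟨n, h1, h2, rfl⟩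
  · rintro ⟨n, h1, h2, rfl⟩; exact ⟨_, ⟨n, ⟨h1, h2⟩, rfl⟩, rfl⟩

/-- The arcs consist of inner boundary sites (`Aᵢ ⊆ ∂⁻G`). [cite: BollobasRiordan2006, Ch. 7 §7.2.2 p. 169] -/
theorem arc_subset_triInnerBdry (i : Fin k) : D.arc i ⊆ triInnerBdry D.verts := by
  intro x hx
  obtain ⟨n, -, -, rfl⟩ := (D.mem_arc_iff).1 hx
  exact Finset.mem_image_of_mem _ (triBdryIter_mem D.base_mem n)

/-- The outer arcs consist of outer boundary sites (`Aᵢ⁺ ⊆ ∂⁺G`). [cite: BollobasRiordan2006, Ch. 7 §7.2.2 p. 169] -/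
theorem outerArc_subset_triOuterBdry (i : Fin k) : D.outerArc i ⊆ triOuterBdry D.verts := by
  intro x hx
  obtain ⟨n, -, -, rfl⟩ := (D.mem_outerArc_iff).1 hx
  exact Finset.mem_image_of_mem _ (triBdryIter_mem D.base_mem n)

/-- Arc sites belong to the domain. [folklore] -/
theorem arc_subset_verts (i : Fin k) : D.arc i ⊆ D.verts := by
  intro x hx
  obtain ⟨n, -, -, rfl⟩ := (D.mem_arc_iff).1 hx
  exact (mem_triBdryDarts.1 (triBdryIter_mem D.base_mem n)).1

/-- Outer arc sites lie outside the domain. [folklore] -/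
theorem outerArc_disjoint_verts (i : Fin k) {x : LatticeModels.Site 2} (hx : x ∈ D.outerArc i) : x ∉ D.verts := by
  obtain ⟨n, -, -, rfl⟩ := (D.mem_outerArc_iff).1 hx
  exact (mem_triBdryDarts.1 (triBdryIter_mem D.base_mem n)).2.1

/-- **The marked site `v_{i+1}` lies on the arc `Aᵢ`** ("We include both `vᵢ` and `v_{i+1}` into
`Aᵢ`", Bollobás–Riordan 2006, p. 169): the dart preceding the marked dart of `v_{i+1}` ends the
stretch of `Aᵢ` and has the tail `v_{i+1}` (`mark_pred`); for the last arc this is the dart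
preceding the base dart, of tail `v₁`. [cite: BollobasRiordan2006, Ch. 7 §7.2.2 p. 169] -/
theorem markSite_succ_mem_arc [NeZero k] (i : Fin k) : D.markSite (i + 1) ∈ D.arc i := by
  rw [D.mem_arc_iff]
  have hL : 0 < D.bdryLen := lt_of_le_of_lt (Nat.zero_le _) (D.pos_lt i)
  refine ⟨D.nextPos i - 1, ?_, ?_, ?_⟩
  · have := D.pos_lt_nextPos i; omega
  · have := D.pos_lt_nextPos i; omega
  · -- the dart before position `nextPos i` has tail `markSite (i + 1)`
    have key : (triBdryIter D.verts D.base (D.pos (i + 1) + (D.bdryLen - 1))).1 = D.markSite (i + 1) :=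
      D.mark_pred (i + 1)
    rw [← key]
    congr 1
    unfold nextPos
    split_ifs with h
    · -- `i + 1` is the next index: `pos (i+1) - 1 + bdryLen ≡ pos (i+1) - 1`
      have e : (i + 1 : Fin k) = ⟨i.val + 1, h⟩ := Fin.ext (by simp [Fin.val_add, Nat.mod_eq_of_lt h])
      rw [e]
      have hp : 0 < D.pos ⟨i.val + 1, h⟩ :=
        lt_of_le_of_lt (Nat.zero_le (D.pos i)) (D.pos_strictMono (show i < ⟨i.val + 1, h⟩ from
          Fin.mk_lt_mk.2 (Nat.lt_succ_self _)))
      have : D.pos ⟨i.val + 1, h⟩ + (D.bdryLen - 1) = (D.pos ⟨i.val + 1, h⟩ - 1) + D.bdryLen := by omega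
      rw [this, triBdryIter_add_bdryLen]
    · -- `i` is the last index: `i + 1 = 0`, `pos 0 = 0`
      have hk : i.val + 1 = k := by have := i.is_lt; omega
      have e : (i + 1 : Fin k) = ⟨0, by omega⟩ := Fin.ext (by simp [Fin.val_add, hk])
      rw [e, D.pos_zero (by omega), zero_add]

end TriMarkedDomain

end Literature.Probability.Percolation

end
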